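import Summits.KontsevichZagierPeriods.KontsevichZagierPeriods.Theorems.SymplecticScissorsVolumeFormOffPlaneCornerCut

/-!
# `VolumeFormOffPlane` (stmt-KontsevichZagierPeriods-14935) — line `Sketch`,
stub `stub_euclideanCornerCut` (Euclidean corner cut: inclusion–exclusion of translated
orthants under an affine cut)

Additive (Euclidean) twin of `stub_cornerCut`.  For a point `x : Fin d → ℝ` off the walls
`x ι = b ι`, with `a ι ≤ b ι`, and the affine half-space `K = {∑ ι, m ι * y ι < c}`,

`1_{∀ ι, a ι < x ι < b ι ∧ K}(x) = ∑_{S ⊆ Fin d} (-1)^{#S} · 1_{∀ ι, e_S ι < x ι ∧ K}(x)`,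

where `e_S ι = b ι` on `S` and `a ι` off `S`.  The combinatorics is the pure-`if` identity
`cc_corner_boole` (product expansion of `∏ ι (1_{a ι < x ι} - 1_{b ι < x ι})`); the common
conjunct `K` is either true (and drops out) or false (and both sides vanish).

Sources: folklore (inclusion–exclusion of translated orthants).
-/

noncomputable section

open MeasureTheory Set
open Literature.NumberTheory.Transcendental

namespace Summit.KontsevichZagierPeriods.SymplecticScissors.LogPolytope

/-- **Euclidean corner cut (inclusion–exclusion of translated orthants).** Off the walls
`x ι = b ι`, with `a ι ≤ b ι`, the indicator of an open box cut by one affine half-space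
`∑ ι, m ι * y ι < c` is the alternating sum over `S ⊆ Fin d` of the indicators of the
corner orthants `{e_S < y} ∩ {∑ ι, m ι * y ι < c}` (`e_S ι = b ι` on `S`, `a ι` off `S`):
the product expansion of `∏_ι (1_{a_ι < x_ι} − 1_{b_ι < x_ι})`, the cut being a common
factor. Pure combinatorics. [folklore] -/
theorem stub_euclideanCornerCut : ∀ (d : ℕ) (a b m : Fin d → ℝ) (c : ℝ) (x : Fin d → ℝ),
    (∀ ι, a ι ≤ b ι) → (∀ ι, x ι ≠ b ι) →
    {y : Fin d → ℝ | (∀ ι, a ι < y ι ∧ y ι < b ι) ∧ ∑ ι, m ι * y ι < c}.indicator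
        (fun _ => (1 : ℝ)) x =
      ∑ S : Finset (Fin d), (-1 : ℝ) ^ S.card *
        {y : Fin d → ℝ | (∀ ι, (if ι ∈ S then b ι else a ι) < y ι) ∧
            ∑ ι, m ι * y ι < c}.indicator (fun _ => (1 : ℝ)) x := by
  intro d a b m c x hab hxb
  classical
  simp only [Set.indicator_apply, Set.mem_setOf_eq]
  by_cases hK : ∑ ι, m ι * x ι < c
  · simp only [hK, and_true]
    exact cc_corner_boole a b x hab hxb
  · simp only [hK, and_false, if_false, mul_zero, Finset.sum_const_zero]

end Summit.KontsevichZagierPeriods.SymplecticScissors.LogPolytope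

end
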